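import Literature.AnabelianGeometry.SemiGraphs.ProSigmaCompletionInjective
import Literature.GroupTheory.CombinatorialGroupTheory.PuncturedSurfaceGroupFree
import Literature.GroupTheory.CombinatorialGroupTheory.PuncturedSurfaceGroupCusps
import HarnessLib

/-!
# Cusp inertia in pro-`Σ` completions of punctured surface groups is infinite

[SemiAnbd] Example 2.10 (p. 31) attaches the branches of a semi-graph of anabelioids of a pointed stable
curve through "the inertia group of one of the cusps" of the pro-`Σ` vertex group; that these closed
procyclic subgroups are INFINITE is the first clause of abc-iut-L3-t11's named fact
`ProSigmaCuspInertiaMalnormal` (`SurfaceTypeEstranged.lean`, input of "totally estranged"; [AbsAnab]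
Lemma 1.3.7) [cite: MochizukiSemiAnbd2006, Ex. 2.10 p.31].  We PROVE that clause for every hyperbolic
type `(g, r)` and every cusp (the existence of a cusp forces `r ≥ 1`, so `Γ_{g,r}` is free): the
completion map is injective on `Γ_{g,r}` (`IsProSigmaCompletion.injective_of_isFreeGroup`, residual
`p`-finiteness of free groups for a prime `p ∈ Σ`) and `c_i ≠ 1` has infinite order
(`PuncturedSurfaceGroup.c_ne_one`).  The second clause (disjointness of conjugates / malnormality) is NOT
treated here.  Theorems only.
-/

namespace Literature.AnabelianGeometry.SemiGraphs.SemiGraphOfAnabelioids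

open Literature.GroupTheory.CombinatorialGroupTheory

universe v

/-- **Cusp inertia subgroups of pro-`Σ` punctured surface groups are infinite**: for a nonempty set of
primes `Σ`, a hyperbolic type `(g, r)`, a pro-`Σ` completion `ι : Γ_{g,r} → P` (`P` a topological group;
no compactness needed) and any cusp `i`, the closure of `ι⟨c_i⟩` is infinite — clause (A) of
`ProSigmaCuspInertiaMalnormal`. [cite: MochizukiSemiAnbd2006, Ex. 2.10 p.31] -/
theorem infinite_cuspInertia_closure {Sigma : Set ℕ} (hne : Sigma.Nonempty)
    (hprime : ∀ p ∈ Sigma, p.Prime) {g r : ℕ} (h : PuncturedSurfaceGroup.IsHyperbolicType g r)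
    {P : Type v} [Group P] [TopologicalSpace P] [IsTopologicalGroup P]
    (ι : PuncturedSurfaceGroup g r →* P) (hι : IsProSigmaCompletion Sigma ι) (i : Fin r) :
    Infinite ((PuncturedSurfaceGroup.cuspInertia (g := g) i).map ι).topologicalClosure := by
  obtain ⟨r', rfl⟩ : ∃ r', r = r' + 1 := ⟨r - 1, by have := i.2; omega⟩
  obtain ⟨e⟩ := PuncturedSurfaceGroup.nonempty_mulEquiv_freeGroup g r'
  haveI : IsFreeGroup (PuncturedSurfaceGroup g (r' + 1)) := IsFreeGroup.ofMulEquiv e.symm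
  obtain ⟨p, hp⟩ := hne
  exact hι.infinite_topologicalClosure_map_zpowers ⟨p, hp, hprime p hp⟩
    (PuncturedSurfaceGroup.c_ne_one h i)

/-- Clause (A) of `ProSigmaCuspInertiaMalnormal` in its quantifier shape (profinite `P`), for the
record. [cite: MochizukiSemiAnbd2006, Ex. 2.10 p.31] -/
theorem proSigmaCuspInertia_infinite :
    ∀ (Sigma : Set ℕ), Sigma.Nonempty → (∀ p ∈ Sigma, p.Prime) →
      ∀ (g r : ℕ), PuncturedSurfaceGroup.IsHyperbolicType g r →
        ∀ (P : Type v) [Group P] [TopologicalSpace P] [IsTopologicalGroup P] [CompactSpace P]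
          [T2Space P] [TotallyDisconnectedSpace P] (ι : PuncturedSurfaceGroup g r →* P),
          IsProSigmaCompletion Sigma ι →
            ∀ i : Fin r,
              Infinite ((PuncturedSurfaceGroup.cuspInertia (g := g) i).map ι).topologicalClosure :=
  fun _ hne hprime _ _ h _ _ _ _ _ _ _ ι hι i => infinite_cuspInertia_closure hne hprime h ι hι i

end Literature.AnabelianGeometry.SemiGraphs.SemiGraphOfAnabelioids
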